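import Mathlib
import HarnessLib
import Literature.Analysis.FluidPDE.LocalTypeI
import Summits.NavierStokesRegularity.NavierStokesRegularity.Theorems.TypeIQuarterGateScarZoomDefs
import Summits.NavierStokesRegularity.NavierStokesRegularity.Theorems.TypeIQuarterGateSliceBudgetV7Defs
import Summits.NavierStokesRegularity.NavierStokesRegularity.Theorems.TerminalTraceTypeITraceScarL3TopSingularNull

/-!
# Crux `TypeIQuarterGate.ScarEnvelopeTypeI` (stmt-NavierStokesRegularity-23843), line `slice_budget` —
# DEDUPLICATION NOTE: the fat kill SF follows from Tsai 1998 (Lemma 4.2, remark), already in the tree,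
# with NO Morrey bound — hence it also constrains scar_zoom's untied twin-scar objects

Helper file (no new definitions).  The tree already proves CKN's Theorem B AT THE TOP of a parabolic
cylinder for every suitable weak solution of Albritton–Barker's ball class
(`Literature.Analysis.FluidPDE.tsai1998_top_singular_null_holds`, T.-P. Tsai, ARMA 143 (1998),
remark after Lemma 4.2; packaged as `Theorems.TypeITraceScarL3.hausdorffMeasure_topSingular_apex_eq_zero`
by seat ns-typeII-p3 for item 18385).  Consequently:

* `finalSingularSet_null_of_inBall` — `(∀ R > 0, IsSuitableWeakSolutionInBall R 0 U P) →
  μH[1] (finalSingularSet U) = 0`: the conclusion of the landed stub SF `stub_fatKill` (p622339) from the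
  SECOND conjunct of `ABClass` ALONE — the Morrey bound `𝐈 < ⊤` used by the LEAD's independent route
  (`…TopEpsilonRegularity.lean` p620112 / `…TopTimeCKN.lean` p620447: Seregin L.6.2/L.6.4 + Vitali) is
  NOT needed; that route is a second, energy-bound proof of the same nullity, kept as a tool;
  (so `FatKill` = `fun M U P H h => finalSingularSet_null_of_inBall h.2.1`; not restated — `stub_fatKill`
  is the landed declaration of that statement);
* `hausdorffMeasure_finalSingular_eq_zero_of_twinScarObject_inBall` — the (β) bridge caveat of KEY-NS
  #117/#118 is LIFTED: scar_zoom's UNTIED residual object (`TwinScarObject M v ∧ ∀ R > 0,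
  IsSuitableWeakSolutionInBall R 0 v P`, the hypothesis of `scarEnvelopeTypeI_of_noABTwinScarObject`
  p617310 and of `octaveBudget_of_noABTwinScarObject` p621370) ALSO has `H¹`-null final-time singular
  set.

HONEST FRAMING: bookkeeping / deduplication by name; SK, S_C′, the crux and the summit are OPEN.
-/

noncomputable section

-- the summit-side namespace `Summit.NavierStokesRegularity.NavierStokesRegularity.…` (single-conjunct
-- summit, D-0017) repeats a component by design; the dupNamespace linter would flag every declaration.
set_option linter.dupNamespace false

namespace Summit.NavierStokesRegularity.NavierStokesRegularity.Cruxes.ScarEnvelopeTypeI.SliceBudget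

open MeasureTheory Set
open scoped ENNReal
open Literature.Analysis Literature.Analysis.FluidPDE
open Summit.NavierStokesRegularity.NavierStokesRegularity.Cruxes.ScarEnvelopeTypeI.ScarZoom (TwinScarObject)

/-- **The final-time singular set of a solution in Albritton–Barker's class on every ball about the
origin is `H¹`-null** (Tsai 1998, remark after Lemma 4.2, tree theorem
`Theorems.TypeITraceScarL3.hausdorffMeasure_topSingular_apex_eq_zero`): no Morrey bound needed. -/
theorem finalSingularSet_null_of_inBall
    {U : ℝ → EuclideanSpace ℝ (Fin 3) → EuclideanSpace ℝ (Fin 3)}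
    {P : ℝ → EuclideanSpace ℝ (Fin 3) → ℝ}
    (hball : ∀ R : ℝ, 0 < R →
      IsSuitableWeakSolutionInBall R ((0 : ℝ), (0 : EuclideanSpace ℝ (Fin 3))) U P) :
    μH[1] (finalSingularSet U) = 0 :=
  Summit.NavierStokesRegularity.NavierStokesRegularity.Theorems.TypeITraceScarL3.hausdorffMeasure_topSingular_apex_eq_zero
    hball

/-- **The (β) caveat lifted: scar_zoom's untied twin-scar residual also has `H¹`-null final-time
singular set.**  For a twin-scar object lying, with some pressure, in Albritton–Barker's class on
every ball (the object of `exists_twinScarObject_inBall`, p617310), the set of `x` with `(0, x)`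
backward singular is `μH[1]`-null (it contains `0` and a unit vector `e` by `TwinScarObject`, via the
continuity of the KNSS gauge). -/
theorem hausdorffMeasure_finalSingular_eq_zero_of_twinScarObject_inBall {M : ℝ}
    {v : ℝ → EuclideanSpace ℝ (Fin 3) → EuclideanSpace ℝ (Fin 3)}
    {P : ℝ → EuclideanSpace ℝ (Fin 3) → ℝ} (_hv : TwinScarObject M v)
    (hball : ∀ R : ℝ, 0 < R →
      IsSuitableWeakSolutionInBall R ((0 : ℝ), (0 : EuclideanSpace ℝ (Fin 3))) v P) :
    μH[1] {x : EuclideanSpace ℝ (Fin 3) | IsBackwardSingularPoint v ((0 : ℝ), x)} = 0 :=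
  Summit.NavierStokesRegularity.NavierStokesRegularity.Theorems.TypeITraceScarL3.hausdorffMeasure_topSingular_apex_eq_zero
    hball

end Summit.NavierStokesRegularity.NavierStokesRegularity.Cruxes.ScarEnvelopeTypeI.SliceBudget

end
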